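import Literature.AlgebraicGeometry.HodgeTheory.QuaternionicQuarticFamilyDeckOfGenericModel
import Summits.HodgeConjecture.HodgeConjecture.Theorems.Q8SymplecticPowersFamilyDeck
import HarnessLib

/-!
# K1Q line `mechanism-v2`: the S6 deck-family ∃-package FROM THE GENERIC `Q₈`-MODEL (Kollár-free re-keying)

Route `HodgeConjecture/Q8SymplecticPowers`, crux K1Q `VeryGeneralQuaternionCommutatorsInHg` (stmt-HodgeConjecture-24190). Helper
(`--supports`; nothing here closes an item). The tree's S6 closer `Q8SymplecticPowersFamilyDeck.stub_familyDeckExistsQ_of_kollar`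
derives the deck-family ∃-package (the family half of the registered stubs `stub_memberLocalCertificateQ4 ∕ Qge6`) from the
all-dimension named fact `Kollar2007_resolutionLiftsAutomorphisms`. By `Q8Family.q8FamilyDeck_of_genericModel`
(`QuaternionicQuarticFamilyDeckOfGenericModel.lean`) the same package follows from the generic smooth projective `Q₈`-model alone:

* `stub_familyDeckExistsQ_of_genericModel` — «for every `e ≥ 2` the generic étale chart has an equivariant smooth projective
  model over `Frac ℂ[a]`» ⟹ the S6 consequent VERBATIM.

The model hypothesis is in turn implied by equivariant resolution of `Q₈`-SURFACES over `Frac ℂ[a]`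
(`Q8Family.exists_genericModel_of_surfaceLifting`), e.g. by the existence of minimal resolutions of surfaces
(`Q8Family.exists_genericModel_of_minimalResolutions`, Bădescu 2001 Thm. 4.3 ∕ Prop. 4.5 — not yet in the tree).

Honest scope: a re-keying of one input of the line; S6's registered form, LCERT, K1Q and HC are NOT proved here.
-/

set_option linter.dupNamespace false

open CategoryTheory AlgebraicGeometry

namespace Summit.HodgeConjecture.HodgeConjecture.Theorems.Q8SymplecticPowersFamilyDeckOfGenericModel

/-- **The S6 deck-family ∃-package from the generic smooth projective `Q₈`-model** (consequent = the registered stub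
`stub_familyDeckExistsQ` minus its Kollár binder, verbatim; proof = `Q8Family.q8FamilyDeck_of_genericModel`).
[cite: Kollar2007, Thm. 3.36 and §3.4.1] [cite: EGAIV3, Thm. 8.10.5] -/
theorem stub_familyDeckExistsQ_of_genericModel
    (hGM : (∀ e : ℕ, 2 ≤ e → ∃ (E : Literature.AlgebraicGeometry.Motives.SchemeOver
        (FractionRing (Literature.AlgebraicGeometry.HodgeTheory.Q8Family.ParamRing e)))
      (ρE : Literature.AlgebraicGeometry.RelativeSpec.ActionOver E.hom (QuaternionGroup 2))
      (θ : Literature.AlgebraicGeometry.HodgeTheory.Q8Family.genericChart e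
        (FractionRing (Literature.AlgebraicGeometry.HodgeTheory.Q8Family.ParamRing e)) ⟶ E),
      Literature.AlgebraicGeometry.Motives.IsSmoothProjective 2 E ∧ AlgebraicGeometry.IsOpenImmersion θ.left ∧
      ∀ g : QuaternionGroup 2,
        ((Literature.AlgebraicGeometry.HodgeTheory.Q8Family.genericAction e
          (FractionRing (Literature.AlgebraicGeometry.HodgeTheory.Q8Family.ParamRing e))).aut g).hom ≫ θ.left =
          θ.left ≫ (ρE.aut g).hom)) :
    open Literature.AlgebraicGeometry.Motives Literature.AlgebraicGeometry.HodgeTheory Literature.AlgebraicGeometry.HodgeTheory.BettiUniverse Literature.AlgebraicGeometry.HodgeTheory.Q8Family Literature.AlgebraicGeometry.RelativeSpec Literature.AlgebraicGeometry.RelativeSpec.ActionOver Literature.Algebra.Lie Literature.Algebra.Lie.KatzRecognition CategoryTheory CategoryTheory.Limits MonoidalCategory CartesianMonoidalCategory AlgebraicGeometry in ∀ ⦃e : ℕ⦄, Even e → 4 ≤ e → ∃ (W : (Spec (.of (ParamRing e))).Opens) (𝒳 : SchemeOver ℂ) (π : 𝒳 ⟶ base W) (τ j : 𝒳 ⟶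 𝒳) (ι : (deckChart (fun i => (MvPolynomial.X i : ParamRing e)) ⊗ Over.mk W.ι).left ⟶ 𝒳.left), Nonempty (ComplexPoints (base W)) ∧ IsSmoothProjectiveFamily π 2 ∧ IsQuasiProjectiveOver 𝒳 ∧ IsQuasiProjectiveOver (base W) ∧ AlgebraicGeometry.SmoothOfRelativeDimension (Fintype.card (CIdx e)) (base W).hom ∧ (τ ≫ π = π ∧ j ≫ π = π ∧ τ ≫ τ ≫ τ ≫ τ = 𝟙 𝒳 ∧ j ≫ j = τ ≫ τ ∧ τ ≫ j ≫ τ = j) ∧ IsOpenImmersion ι ∧ ι ≫ π.left = (snd (deckChart (fun i => (MvPolynomial.X i : ParamRing e))) (Over.mk W.ι)).left ∧ ((Over.isoMk ((deckAction (fun i => (MvPolynomial.X i : ParamRing e))).aut (QuaternionGroup.a 1)) ((deckAction (fun i => (MvPolynomial.X i : ParamRing e))).aut_comp (QuaternionGroup.a 1))).hom ▷ Over.mk W.ι).left ≫ ι = ι ≫ τ.left ∧ ((Over.isoMk ((deckAction (fun i => (MvPolynomial.X i : ParamRing e))).aut (QuaternionGroup.xa 0)) ((deckAction (fun i => (MvPolynomial.X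 i : ParamRing e))).aut_comp (QuaternionGroup.xa 0))).hom ▷ Over.mk W.ι).left ≫ ι = ι ≫ j.left ∧ Function.Surjective (snd (deckChart (fun i => (MvPolynomial.X i : ParamRing e))) (Over.mk W.ι)).left := by
  intro e _ h4
  exact Literature.AlgebraicGeometry.HodgeTheory.Q8Family.q8FamilyDeck_of_genericModel e (by omega) (hGM e (by omega))

end Summit.HodgeConjecture.HodgeConjecture.Theorems.Q8SymplecticPowersFamilyDeckOfGenericModel
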